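import Literature.NumberTheory.Automorphic.UnitaryGroupAdelicCenter
import Mathlib.Topology.Algebra.Group.Matrix
import HarnessLib

/-!
# The determinant `det : U(J)(𝔸_F) → U(1)(𝔸_F)` of an adelic unitary group

For a quadratic extension `E/F` with conjugation `c` and a form `J ∈ M_N(E)` with `det J ≠ 0`, the
determinant of `g ∈ U(J)(𝔸_F) = {g ∈ GL_N(𝔸_E) | ((c ⊗ 1) g)ᵀ J g = J}` satisfies
`(c ⊗ 1)(det g) · det g = 1` (take determinants in the defining relation and cancel the unit
`det J`), i.e. `det g ∈ U(1)(𝔸_F)`; this gives the homomorphism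

* `UnitaryGroup.adelicDet F E c N J hJ : adelic F E c N J →* adelicOne F E c`

(`coe_adelicDet`: its underlying idele is `det g`; `continuous_adelicDet`), with

* `adelicDet_adelicCenter : adelicDet (u · 1_N) = u ^ N` — the determinant on the centre, so a
  character `χ ∘ det` of `U(J)(𝔸_F)` restricts to `u ↦ χ(u)^N` on `U(1)(𝔸_F) = Z(U(J))(𝔸_F)`;
* `coe_adelicDet_toAdelic : det` of a rational point `γ ∈ U(J)(F)` is the principal idele `det γ`.

References: [Mok2014, §1 Notation p. 5] (`U_{E/F}(N)`, its centre `U_{E/F}(1)`, `det`);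
[GelbartRogawski1991, §3.1 Remark p. 457 L9–13] ("if `s*` is any other compatible splitting, then
`s* = s ⊗ ν′`, where `ν′` is an automorphic character of `E¹`, regarded as a character of `G`" — i.e.
through `det : G → E¹ = U(1)`). KERNEL ONLY: 0 records, 0 named facts, 0 sorry. Model-construction cell pub-hodgecm,
node W2-Kn (the normalising character of record is `(η_V ∘ det) ⊠ (η_W ∘ det)`).
-/

set_option autoImplicit false

noncomputable section

open NumberField

namespace Literature.NumberTheory.Automorphic

namespace UnitaryGroup

section Det

variable (F E : Type) [Field F] [Field E] [NumberField E] [Algebra F E] (c : E ≃ₐ[F] E)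
variable (N : ℕ) (J : Matrix (Fin N) (Fin N) E)

/-- `det` of the adelic form `J ⊗ 1` is the (principal) adele `det J`. [folklore] -/
theorem det_adelicForm :
    (adelicForm E N J).det = algebraMap E (AdeleRing (𝓞 E) E) J.det :=
  (RingHom.map_det (algebraMap E (AdeleRing (𝓞 E) E)) J).symm

/-- for `det J ≠ 0` the adele `det (J ⊗ 1)` is a unit of `𝔸_E`. [folklore] -/
theorem isUnit_det_adelicForm (hJ : J.det ≠ 0) : IsUnit (adelicForm E N J).det := by
  rw [det_adelicForm]
  exact (IsUnit.mk0 _ hJ).map _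

/-- `det ((c ⊗ 1) g) = (c ⊗ 1)(det g)` (entrywise conjugation commutes with `det`). [folklore] -/
theorem det_map_conjAdele (g : Matrix (Fin N) (Fin N) (AdeleRing (𝓞 E) E)) :
    (g.map (conjAdele F E c)).det = conjAdele F E c g.det :=
  (RingHom.map_det (conjAdele F E c) g).symm

/-- **`(c ⊗ 1)(det g) · det g = 1` for `g ∈ U(J)(𝔸_F)`** when `det J ≠ 0`: determinants in
`((c ⊗ 1) g)ᵀ J g = J`, then cancel the unit `det J`. [cite: Mok2014, §1 Notation p. 5] -/
theorem conjAdele_det_mul_det (hJ : J.det ≠ 0) (g : adelic F E c N J) :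
    conjAdele F E c ((g : GL (Fin N) (AdeleRing (𝓞 E) E)) : Matrix (Fin N) (Fin N) (AdeleRing (𝓞 E) E)).det *
        ((g : GL (Fin N) (AdeleRing (𝓞 E) E)) : Matrix (Fin N) (Fin N) (AdeleRing (𝓞 E) E)).det = 1 := by
  have h := congrArg Matrix.det (mem_unitaryGroupOfForm_iff.1 g.2)
  rw [Matrix.det_mul, Matrix.det_mul, Matrix.det_transpose, det_map_conjAdele, mul_right_comm] at h
  exact (isUnit_det_adelicForm E N J hJ).mul_right_cancel (h.trans (one_mul _).symm)

/-- the determinant of `g ∈ U(J)(𝔸_F)`, as an idele, lies in `U(1)(𝔸_F)`. [folklore] -/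
theorem det_mem_adelicOne (hJ : J.det ≠ 0) (g : adelic F E c N J) :
    Matrix.GeneralLinearGroup.det (g : GL (Fin N) (AdeleRing (𝓞 E) E)) ∈ adelicOne F E c :=
  conjAdele_det_mul_det F E c N J hJ g

/-- **the determinant `det : U(J)(𝔸_F) →* U(1)(𝔸_F)`** (for `det J ≠ 0`). [cite: Mok2014, §1 Notation p. 5] -/
def adelicDet (hJ : J.det ≠ 0) : adelic F E c N J →* adelicOne F E c :=
  MonoidHom.codRestrict (Matrix.GeneralLinearGroup.det.comp (adelic F E c N J).subtype) (adelicOne F E c)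
    fun g => det_mem_adelicOne F E c N J hJ g

/-- underlying idele of `adelicDet g`: `det g`. [folklore] -/
@[simp] theorem coe_adelicDet (hJ : J.det ≠ 0) (g : adelic F E c N J) :
    ((adelicDet F E c N J hJ g : adelicOne F E c) : (AdeleRing (𝓞 E) E)ˣ) =
      Matrix.GeneralLinearGroup.det (g : GL (Fin N) (AdeleRing (𝓞 E) E)) :=
  rfl

/-- underlying adele of `adelicDet g`: the matrix determinant of `g`. [folklore] -/
theorem coe_coe_adelicDet (hJ : J.det ≠ 0) (g : adelic F E c N J) :
    (((adelicDet F E c N J hJ g : adelicOne F E c) : (AdeleRing (𝓞 E) E)ˣ) : AdeleRing (𝓞 E) E) =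
      ((g : GL (Fin N) (AdeleRing (𝓞 E) E)) : Matrix (Fin N) (Fin N) (AdeleRing (𝓞 E) E)).det :=
  rfl

/-- `adelicDet` is continuous (the determinant `GL_N(𝔸_E) → 𝔸_Eˣ` is). [folklore] -/
theorem continuous_adelicDet (hJ : J.det ≠ 0) : Continuous (adelicDet F E c N J hJ) :=
  (Matrix.GeneralLinearGroup.continuous_det.comp continuous_subtype_val).subtype_mk _

/-- **`det (u · 1_N) = u ^ N`**: the determinant on the centre `U(1)(𝔸_F) → U(J)(𝔸_F)`. [folklore] -/
@[simp] theorem adelicDet_adelicCenter (hJ : J.det ≠ 0) (u : adelicOne F E c) :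
    adelicDet F E c N J hJ (adelicCenter F E c N J u) = u ^ N :=
  Subtype.ext (det_adelicCenter F E c N J u)

/-- as homomorphisms: `det ∘ (centre) = (· ^ N)`. [folklore] -/
theorem adelicDet_comp_adelicCenter (hJ : J.det ≠ 0) :
    (adelicDet F E c N J hJ).comp (adelicCenter F E c N J) = powMonoidHom N :=
  MonoidHom.ext fun u => adelicDet_adelicCenter F E c N J hJ u

/-- a character `χ ∘ det` of `U(J)(𝔸_F)` on the centre: `χ(det (u · 1_N)) = χ(u) ^ N`. [folklore] -/
theorem comp_adelicDet_adelicCenter {A : Type} [CommMonoid A] (hJ : J.det ≠ 0) (χ : adelicOne F E c →* A)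
    (u : adelicOne F E c) :
    χ (adelicDet F E c N J hJ (adelicCenter F E c N J u)) = χ u ^ N := by
  rw [adelicDet_adelicCenter, map_pow]

/-- **rational points go to principal ideles**: for `γ ∈ U(J)(F)`, the idele `det (γ ⊗ 1)` is the
principal idele of `det γ ∈ Eˣ`. [folklore] -/
theorem coe_adelicDet_toAdelic (hJ : J.det ≠ 0) (γ : rational F E c N J) :
    ((adelicDet F E c N J hJ (toAdelic F E c N J γ) : adelicOne F E c) : (AdeleRing (𝓞 E) E)ˣ) =
      Units.map (algebraMap E (AdeleRing (𝓞 E) E)).toMonoidHom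
        (Matrix.GeneralLinearGroup.det (γ : GL (Fin N) E)) :=
  Units.ext (RingHom.map_det (algebraMap E (AdeleRing (𝓞 E) E)) ((γ : GL (Fin N) E) : Matrix (Fin N) (Fin N) E)).symm

end Det

end UnitaryGroup

end Literature.NumberTheory.Automorphic

end
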